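import Literature.Algebra.Module.ThreeTermComplexBaseChangeLocal
import Mathlib.RingTheory.Flat.Localization
import HarnessLib

/-!
# The exchange locus of a window is the free locus of `coker g`, hence OPEN (Hartshorne III 12.11 (a): «and the same is true
# for all `y'` in a suitable neighborhood of `y`»; EGA III 7.8.4)

Topic `Algebra/Module`; namespace `Literature.Algebra.Module`; theorems only (no definition, named fact, instance, notation,
`sorry`; Mathlib + ★ `Algebra/Module/ThreeTermComplexBaseChangeLocal`). Row ★ proves Hartshorne III Thm. 12.11 (a) AT THE
LOCAL RING: for a window `K⁰ —f→ K¹ —g→ K²` (`g ∘ f = 0`) over a local ring with `K¹` finite and `K²` finite free, `φ(k)`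
surjective («every cycle of `K ⊗ k` is a base-changed cycle plus a boundary», `ker(g ⊗ k) ≤ im((ker g ↪ K¹) ⊗ k) ⊔ im(f ⊗ k)`)
iff `coker g` is free. This file GLOBALISES it over ANY commutative ring `A` (`K¹` finite, `K²` finite projective): at a prime
`𝔭`, **`φ(κ(𝔭))` is surjective iff `𝔭` lies in the FREE LOCUS of `coker g`** (Mathlib `Module.freeLocus`), by transporting row
★'s criterion over `A_𝔭` back to `A` along Mathlib's `AlgebraTensorModule.cancelBaseChange : κ(𝔭) ⊗_{A_𝔭} (A_𝔭 ⊗_A K) ≃ κ(𝔭)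
⊗_A K` (naturality `lTensor_comp_cancelBaseChange`), flatness of `A_𝔭` (`ker(g ⊗ A_𝔭) = (ker g) ⊗ A_𝔭`, Mathlib
`Module.Flat.lTensor_exact`, `Localization.flat`) and `Module.mem_freeLocus_iff_tensor`; hence **the EXCHANGE LOCUS is OPEN**
(Mathlib `Module.isOpen_freeLocus`, `coker g` being finitely presented) — Hartshorne's «the same is true for all `y'` in a
suitable neighborhood of `y`» (held PDF p0351) and the openness of the exchange locus of EGA III 7.8.4.

* `map_cancelBaseChange_ker_baseChange`, `map_cancelBaseChange_range_baseChange`,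
  `map_cancelBaseChange_range_kerSubtype_baseChange` — the three transports along `cancelBaseChange` (the last one through
  flatness of `A_𝔭`);
* **`mem_freeLocus_coker_iff_ker_baseChange_residueField_le`** — `𝔭 ∈ freeLocus (coker g) ⟺ φ(κ(𝔭))` surjective;
* **`isOpen_setOf_ker_baseChange_residueField_le`** — the exchange locus `{𝔭 ; φ(κ(𝔭)) surjective}` is OPEN;
* `exists_nhd_exchange_of_ker_baseChange_residueField_le` — Hartshorne's neighbourhood clause verbatim: surjective at `𝔭` ⇒
  surjective at every `𝔮` of an open `U ∋ 𝔭`.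

What is NOT here: the exchange isomorphism over `A_𝔮` ∕ over `B` for `𝔮 ∈ U` (row ★ at each local ring, or row
`ThreeTermComplexBaseChange` once `coker g` is projective on an open — the passage `freeLocus ⊇ U ⇒ (coker g)_s projective
over A_s` is Mathlib `Module.FinitePresentation.exists_free_localizedModule_powers`, not restated), the scheme form,
non-projective `K²`. Kin BY DECL: ★ `free_coker_iff_ker_baseChange_residueField_le` (the local criterion — imported engine), ★
`RingTheory/FittingIdeal/LocallyFreeRankLocus` (free locus of constant rank via Fitting ideals — a different parametrisation
of the same open set when the rank is fixed), rows `HomologyExactLocusOpen` ∕ `QuasiIsoLocusOpen` ∕ `AcyclicQuasiIsoLocusOpen`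
(open loci of FLAT base changes `R_𝔭 ⊗ K` — exactness, not exchange), ★ `RingTheory/Flat/LocalCriterionLevelwiseFreeLocus`
(membership of a prime in a FLAT ∕ free locus from LEVELWISE projectivity `B/Iⁿ ⊗ M` — a different hypothesis and conclusion;
shares only the `freeLocus` ∕ `cancelBaseChange` vocabulary). Library only (cell `pub-hodge-ring2`, count-neutral); proves
nothing about any crux, route or conjecture.

## References

* R. Hartshorne, *Algebraic Geometry*, GTM 52 (1977), III Thm. 12.11 (a) (p. 290; held PDF p0351). [Hartshorne1977]
* A. Grothendieck, EGA III₂ (1963), 7.7.10, 7.8.4. [EGAIII2]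
-/

universe u
open TensorProduct Module IsLocalRing

namespace Literature.Algebra.Module

section Transport

variable {A : Type u} [CommRing A] (R : Type u) [CommRing R] [Algebra A R] (k : Type u) [CommRing k] [Algebra A k]
  [Algebra R k] [IsScalarTower A R k]
  {M N : Type u} [AddCommGroup M] [Module A M] [AddCommGroup N] [Module A N]

/-- Naturality of Mathlib's `cancelBaseChange : k ⊗_R (R ⊗_A M) ≃ k ⊗_A M` in the module: it intertwines `(h ⊗ R) ⊗ k` with `h ⊗
k` for an `A`-linear `h : M → N`. This is the `LinearMap.baseChange` SPELLING — a bridge, not a result — of Mathlib's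
`TensorProduct.AlgebraTensorModule.lTensor_comp_cancelBaseChange` (`LinearAlgebra/TensorProduct/Tower.lean` l.456), proved
pointwise by tensor induction and the `rfl`-lemma `cancelBaseChange_tmul`. [cite: Hartshorne1977, III Thm. 12.11 (a) (p. 290)] -/
theorem cancelBaseChange_baseChange_baseChange_apply (h : M →ₗ[A] N) (y : k ⊗[R] (R ⊗[A] M)) :
    AlgebraTensorModule.cancelBaseChange A R k k N ((h.baseChange R).baseChange k y) =
      h.baseChange k (AlgebraTensorModule.cancelBaseChange A R k k M y) := by
  induction y using TensorProduct.induction_on with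
  | zero => simp only [map_zero]
  | tmul c z =>
    induction z using TensorProduct.induction_on with
    | zero => simp only [tmul_zero, map_zero]
    | tmul r x =>
      rw [LinearMap.baseChange_tmul, LinearMap.baseChange_tmul, AlgebraTensorModule.cancelBaseChange_tmul,
        AlgebraTensorModule.cancelBaseChange_tmul, LinearMap.baseChange_tmul]
    | add z₁ z₂ h₁ h₂ => simp only [tmul_add, map_add, h₁, h₂]
  | add y₁ y₂ h₁ h₂ => simp only [map_add, h₁, h₂]

/-- Transport of KERNELS along `cancelBaseChange`: `ker((g ⊗ R) ⊗ k) ↦ ker(g ⊗ k)`. [cite: Hartshorne1977, III Thm. 12.11 (a) (p.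
290)] -/
theorem map_cancelBaseChange_ker_baseChange (h : M →ₗ[A] N) :
    (LinearMap.ker ((h.baseChange R).baseChange k)).map (AlgebraTensorModule.cancelBaseChange A R k k M).toLinearMap =
      LinearMap.ker (h.baseChange k) := by
  rw [Submodule.map_equiv_eq_comap_symm]
  ext x
  simp only [Submodule.mem_comap, LinearMap.mem_ker, LinearEquiv.coe_coe]
  rw [← (AlgebraTensorModule.cancelBaseChange A R k k N).injective.eq_iff, map_zero,
    cancelBaseChange_baseChange_baseChange_apply, LinearEquiv.apply_symm_apply]

/-- Transport of RANGES along `cancelBaseChange`: `im((h ⊗ R) ⊗ k) ↦ im(h ⊗ k)`. [cite: Hartshorne1977, III Thm. 12.11 (a) (p.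
290)] -/
theorem map_cancelBaseChange_range_baseChange (h : M →ₗ[A] N) :
    (LinearMap.range ((h.baseChange R).baseChange k)).map (AlgebraTensorModule.cancelBaseChange A R k k N).toLinearMap =
      LinearMap.range (h.baseChange k) := by
  ext x
  simp only [Submodule.mem_map, LinearMap.mem_range, LinearEquiv.coe_coe]
  constructor
  · rintro ⟨_, ⟨y, rfl⟩, rfl⟩
    exact ⟨AlgebraTensorModule.cancelBaseChange A R k k M y, (cancelBaseChange_baseChange_baseChange_apply R k h y).symm⟩
  · rintro ⟨y, rfl⟩
    refine ⟨(h.baseChange R).baseChange k ((AlgebraTensorModule.cancelBaseChange A R k k M).symm y), ⟨_, rfl⟩, ?_⟩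
    rw [cancelBaseChange_baseChange_baseChange_apply, LinearEquiv.apply_symm_apply]

/-- Transport of the BASE-CHANGED CYCLES along `cancelBaseChange` when `R` is FLAT over `A` (e.g. `R = A_𝔭`): the cycles of `g ⊗
R` are `(ker g) ⊗ R` (Mathlib `Module.Flat.lTensor_exact`), so `im((ker(g ⊗ R) ↪ R ⊗ K¹) ⊗ k) ↦ im((ker g ↪ K¹) ⊗ k)`. [cite:
Hartshorne1977, III Thm. 12.11 (a) (p. 290)] -/
theorem map_cancelBaseChange_range_kerSubtype_baseChange [Module.Flat A R] (h : M →ₗ[A] N) :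
    (LinearMap.range ((LinearMap.ker (h.baseChange R)).subtype.baseChange k)).map
        (AlgebraTensorModule.cancelBaseChange A R k k M).toLinearMap =
      LinearMap.range ((LinearMap.ker h).subtype.baseChange k) := by
  -- flatness: `(ker h) ⊗ R ↠ ker(h ⊗ R)`
  have hex : Function.Exact ((LinearMap.ker h).subtype.baseChange R) (h.baseChange R) := by
    have := Module.Flat.lTensor_exact R (LinearMap.exact_subtype_ker_map h)
    rwa [← LinearMap.baseChange_eq_ltensor, ← LinearMap.baseChange_eq_ltensor] at this
  have hmem : ∀ x : R ⊗[A] ↥(LinearMap.ker h), (LinearMap.ker h).subtype.baseChange R x ∈ LinearMap.ker (h.baseChange R) :=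
    fun x => by rw [LinearMap.exact_iff.1 hex]; exact LinearMap.mem_range_self _ x
  have hθ : Function.Surjective (LinearMap.codRestrict (LinearMap.ker (h.baseChange R))
      ((LinearMap.ker h).subtype.baseChange R) hmem) := by
    rintro ⟨y, hy⟩
    rw [LinearMap.exact_iff.1 hex] at hy
    obtain ⟨x, rfl⟩ := LinearMap.mem_range.1 hy
    exact ⟨x, rfl⟩
  have hfac : (LinearMap.ker (h.baseChange R)).subtype ∘ₗ
      LinearMap.codRestrict (LinearMap.ker (h.baseChange R)) ((LinearMap.ker h).subtype.baseChange R) hmem =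
        (LinearMap.ker h).subtype.baseChange R := LinearMap.ext fun _ => rfl
  -- hence the two base-changed ranges in `k ⊗_R (R ⊗ K¹)` agree
  have hrange : LinearMap.range ((LinearMap.ker (h.baseChange R)).subtype.baseChange k) =
      LinearMap.range (((LinearMap.ker h).subtype.baseChange R).baseChange k) := by
    rw [← hfac, LinearMap.baseChange_comp, LinearMap.range_comp_of_range_eq_top]
    exact LinearMap.range_eq_top.2 (LinearMap.baseChange_surjective k hθ)
  rw [hrange]
  exact map_cancelBaseChange_range_baseChange R k (LinearMap.ker h).subtype

end Transport

section Locus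

variable {A : Type u} [CommRing A]
  {K0 K1 K2 : Type u} [AddCommGroup K0] [Module A K0] [AddCommGroup K1] [Module A K1]
  [AddCommGroup K2] [Module A K2] [Module.Finite A K1] [Module.Finite A K2] [Module.Projective A K2]
  {f : K0 →ₗ[A] K1} {g : K1 →ₗ[A] K2} (hfg : g ∘ₗ f = 0)
include hfg

/-- **The exchange locus is the free locus of `coker g`** (Hartshorne III Thm. 12.11 (a) globalised; EGA III 7.8.4 at a point):
for a window `K⁰ —f→ K¹ —g→ K²` with `K¹` finite and `K²` finite projective over ANY commutative ring `A` and a prime `𝔭`,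
`φ(κ(𝔭))` is surjective — `ker(g ⊗ κ(𝔭)) ≤ im((ker g ↪ K¹) ⊗ κ(𝔭)) ⊔ im(f ⊗ κ(𝔭))` — iff `(coker g)_𝔭` is free over `A_𝔭` (row
★'s local criterion over `A_𝔭`, transported to `A` along `cancelBaseChange` and the flatness of `A_𝔭`). [cite: Hartshorne1977,
III Thm. 12.11 (a) (p. 290; held PDF p0351)] -/
theorem mem_freeLocus_coker_iff_ker_baseChange_residueField_le (p : PrimeSpectrum A) :
    p ∈ Module.freeLocus A (K2 ⧸ LinearMap.range g) ↔
      LinearMap.ker (g.baseChange p.asIdeal.ResidueField) ≤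
        LinearMap.range ((LinearMap.ker g).subtype.baseChange p.asIdeal.ResidueField) ⊔
          LinearMap.range (f.baseChange p.asIdeal.ResidueField) := by
  set R := Localization.AtPrime p.asIdeal
  -- the window over `A_𝔭`
  have hfgR : g.baseChange R ∘ₗ f.baseChange R = 0 := by rw [← LinearMap.baseChange_comp, hfg, LinearMap.baseChange_zero]
  haveI : Module.Free R (R ⊗[A] K2) := Module.free_of_flat_of_isLocalRing
  -- LHS: `(coker g)_𝔭` free ⟺ `coker(g ⊗ A_𝔭)` free
  have hL : p ∈ Module.freeLocus A (K2 ⧸ LinearMap.range g) ↔ Module.Free R ((R ⊗[A] K2) ⧸ LinearMap.range (g.baseChange R)) := by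
    rw [Module.mem_freeLocus_iff_tensor p R]
    exact ⟨fun _ => Module.Free.of_equiv (Literature.RingTheory.Flat.tensorQuotRangeEquiv R g),
      fun _ => Module.Free.of_equiv (Literature.RingTheory.Flat.tensorQuotRangeEquiv R g).symm⟩
  rw [hL, free_coker_iff_ker_baseChange_residueField_le hfgR]
  -- RHS: transport along `cancelBaseChange : κ(𝔭) ⊗_{A_𝔭} (A_𝔭 ⊗_A K¹) ≃ κ(𝔭) ⊗_A K¹`
  set c := AlgebraTensorModule.cancelBaseChange A R p.asIdeal.ResidueField p.asIdeal.ResidueField K1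
  rw [← Submodule.map_le_map_iff_of_injective c.injective (LinearMap.ker _), Submodule.map_sup]
  change ((LinearMap.ker ((g.baseChange R).baseChange _)).map c.toLinearMap ≤
      (LinearMap.range ((LinearMap.ker (g.baseChange R)).subtype.baseChange _)).map c.toLinearMap ⊔
        (LinearMap.range ((f.baseChange R).baseChange _)).map c.toLinearMap) ↔ _
  rw [map_cancelBaseChange_ker_baseChange R p.asIdeal.ResidueField g,
    map_cancelBaseChange_range_kerSubtype_baseChange R p.asIdeal.ResidueField g,
    map_cancelBaseChange_range_baseChange R p.asIdeal.ResidueField f]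

/-- **The exchange locus is OPEN** (Hartshorne III Thm. 12.11 (a): «the same is true for all `y'` in a suitable neighborhood of
`y`»; EGA III 7.8.4): `{𝔭 ; φ(κ(𝔭)) surjective}` is open in `Spec A` — it is the free locus of the finitely presented module
`coker g` (Mathlib `Module.isOpen_freeLocus`). [cite: Hartshorne1977, III Thm. 12.11 (a) (p. 290; held PDF p0351)] -/
theorem isOpen_setOf_ker_baseChange_residueField_le :
    IsOpen {p : PrimeSpectrum A | LinearMap.ker (g.baseChange p.asIdeal.ResidueField) ≤
      LinearMap.range ((LinearMap.ker g).subtype.baseChange p.asIdeal.ResidueField) ⊔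
        LinearMap.range (f.baseChange p.asIdeal.ResidueField)} := by
  have hset : {p : PrimeSpectrum A | LinearMap.ker (g.baseChange p.asIdeal.ResidueField) ≤
      LinearMap.range ((LinearMap.ker g).subtype.baseChange p.asIdeal.ResidueField) ⊔
        LinearMap.range (f.baseChange p.asIdeal.ResidueField)} = Module.freeLocus A (K2 ⧸ LinearMap.range g) :=
    Set.ext fun p => (mem_freeLocus_coker_iff_ker_baseChange_residueField_le hfg p).symm
  rw [hset]
  haveI : Module.FinitePresentation A K2 := Module.finitePresentation_of_projective A K2
  haveI : Module.FinitePresentation A (K2 ⧸ LinearMap.range g) :=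
    Module.finitePresentation_of_surjective (LinearMap.range g).mkQ (Submodule.mkQ_surjective _)
      (by rw [Submodule.ker_mkQ]; exact Submodule.fg_range g)
  exact Module.isOpen_freeLocus

/-- **Hartshorne III 12.11 (a), neighbourhood clause, verbatim form**: if `φ(κ(𝔭))` is surjective at `𝔭` then there is an open
neighbourhood `U ∋ 𝔭` in `Spec A` at every point `𝔮` of which `φ(κ(𝔮))` is surjective. [cite: Hartshorne1977, III Thm. 12.11
(a) (p. 290; held PDF p0351)] -/
theorem exists_nhd_exchange_of_ker_baseChange_residueField_le (p : PrimeSpectrum A)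
    (hp : LinearMap.ker (g.baseChange p.asIdeal.ResidueField) ≤
      LinearMap.range ((LinearMap.ker g).subtype.baseChange p.asIdeal.ResidueField) ⊔
        LinearMap.range (f.baseChange p.asIdeal.ResidueField)) :
    ∃ U : Set (PrimeSpectrum A), IsOpen U ∧ p ∈ U ∧ ∀ q ∈ U,
      LinearMap.ker (g.baseChange q.asIdeal.ResidueField) ≤
        LinearMap.range ((LinearMap.ker g).subtype.baseChange q.asIdeal.ResidueField) ⊔
          LinearMap.range (f.baseChange q.asIdeal.ResidueField) :=
  ⟨_, isOpen_setOf_ker_baseChange_residueField_le hfg, hp, fun _ hq => hq⟩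

end Locus

end Literature.Algebra.Module
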